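import Summits.AtomisticToContinuum.Crystallization.Theorems.OverbindingBudgetAffineCompressedCutInnerS
import Summits.AtomisticToContinuum.Crystallization.Theorems.OverbindingBudgetAffineCompressedCutOuter

/-!
# `OverbindingBudget` / crux `RobustDefectLimitWindows` (stmt-AtomisticToContinuum-31280) — «InnerA»: first shell, tables, fibres

Support file (lens-4, residual programme (iii) «CompressedCut», leaf `NearFieldSlackMinSecond 12 (1/25)`; plan «Inner» I1/I3).
The pieces of the inner-ball estimate that do not need the whole record at once:

* §1 `t0_window`, `first_shell_value` — a registered first-shell neighbour (`ν ≤ d ≤ 1.0011ν`, `ν < 17/20`) contributes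
  `min (½V(d)) (V(d)) = ½V(d) ≥ t₀²/24 − t₀/12`, `t₀ = (1.0011ν)⁻⁶ ≥ 2`, and `t₀ ≥ 0.9934·ν⁻⁶`;
* §2 `first_shell_dist`, `twelve_le_card` — the `12` kissing vectors of `P i` register `12` distinct sites at distance `∈ [ν, 1.0011ν]`;
* §3 `sum_le_table`, `eq_of_tsub_eq`, `site_eq` — an injective family of table rows has `Σ t ≤` the table total; two inner sites of one
  layer with the same table KEY coincide (clause 5 of the record);
* §4 ★ `table_total` — over any set of inner, non-first-shell sites `m ≠ i` labelled by the record (clause 4), `Σ_m t(m) ≤ 2435912`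
  (fibrewise over the eleven layers: per layer the rows are distinct members of the class table, whose total is `≤ M_{|ℓ|}` by «InnerT»).
[this file: statements + proofs; no new definitions]
-/

namespace Summit.AtomisticToContinuum.Crystallization.Theorems.OverbindingBudgetAffineCompressedCutInnerA

open scoped BigOperators Classical
open Literature.MathematicalPhysics.StatisticalMechanics
open Literature.Geometry.DiscreteGeometry (nearestDist nearestDist_nonneg nearestDist_le_dist fccTwoShellPattern hcpTwoShellPattern fccKissingPattern
  hcpKissingPattern fccKissingPattern_subset hcpKissingPattern_subset card_fccKissingPattern card_hcpKissingPattern norm_eq_one_of_mem_fccKissingPattern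
  norm_eq_one_of_mem_hcpKissingPattern)
open Summit.AtomisticToContinuum.Crystallization.Theorems.OverbindingBudgetAffineCompressedCutKernel (T3 tsub tadd thsum fccL fccNegL hcpL hcpAltL)
open Summit.AtomisticToContinuum.Crystallization.Theorems.OverbindingBudgetAffineCompressedCutCharts (mv)
open Summit.AtomisticToContinuum.Crystallization.Theorems.OverbindingBudgetAffineCompressedCutEstablish (Estab)
open Summit.AtomisticToContinuum.Crystallization.Theorems.OverbindingBudgetAffineCompressedCutSeed (InLayer inLayer_tsub)
open Summit.AtomisticToContinuum.Crystallization.Theorems.OverbindingBudgetAffineCompressedCutPatch (capv dL)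
open Summit.AtomisticToContinuum.Crystallization.Theorems.OverbindingBudgetAffineCompressedCutBudget (tauR dR)
open Summit.AtomisticToContinuum.Crystallization.Theorems.OverbindingBudgetAffineCompressedCutInnerT (tblOf Mq tOfE sgOf eOf sum_Mq)
open Summit.AtomisticToContinuum.Crystallization.Theorems.OverbindingBudgetAffineCompressedCutInnerS (layer_sound sgOf_ne_zero col_form site_bound)

variable {N : ℕ}

/-! ## §1  The first-shell value -/

/-- `t₀ = (1.0011ν)⁻⁶ ≥ 2` and `t₀ ≥ 0.9934·ν⁻⁶` for `0 < ν < 17/20`. [this file] -/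
theorem t0_window {ν : ℝ} (hν : 0 < ν) (hν1 : ν < 17 / 20) :
    2 ≤ (10011 / 10000 * ν)⁻¹ ^ 6 ∧ 9934 / 10000 * ν⁻¹ ^ 6 ≤ (10011 / 10000 * ν)⁻¹ ^ 6 := by
  constructor
  · have hx : 10011 / 10000 * ν < 851 / 1000 := by linarith
    have hx6 : (10011 / 10000 * ν) ^ 6 < 1 / 2 :=
      lt_of_lt_of_le (pow_lt_pow_left₀ hx (by positivity) (by norm_num)) (by norm_num)
    rw [inv_pow, le_inv_comm₀ (by norm_num) (by positivity)]
    linarith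
  · rw [mul_inv, mul_pow]
    exact mul_le_mul_of_nonneg_right (by norm_num) (by positivity)

/-- FIRST-SHELL VALUE: for `ν ≤ d ≤ 1.0011ν`, `0 < ν < 17/20`: `t₀²/24 − t₀/12 ≤ min (½V(d)) (V(d))`. [this file] -/
theorem first_shell_value {ν d : ℝ} (hν : 0 < ν) (hν1 : ν < 17 / 20) (h1 : ν ≤ d) (h2 : d ≤ 10011 / 10000 * ν) :
    ((10011 / 10000 * ν)⁻¹ ^ 6) ^ 2 / 24 - (10011 / 10000 * ν)⁻¹ ^ 6 / 12 ≤ min (1 / 2 * lennardJones d) (lennardJones d) := by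
  obtain ⟨ht2, -⟩ := t0_window hν hν1
  have hd : 0 < d := hν.trans_le h1
  have hts : (10011 / 10000 * ν)⁻¹ ^ 6 ≤ d⁻¹ ^ 6 := pow_le_pow_left₀ (by positivity) (inv_anti₀ hd h2) 6
  have hV : lennardJones d = (d⁻¹ ^ 6) ^ 2 / 12 - d⁻¹ ^ 6 / 6 := by unfold lennardJones; ring
  have hV0 : 0 ≤ lennardJones d := by rw [hV]; nlinarith [hts, ht2]
  rw [min_eq_left (by linarith), hV]
  nlinarith [mul_nonneg (sub_nonneg.2 hts) (by linarith : 0 ≤ d⁻¹ ^ 6 + (10011 / 10000 * ν)⁻¹ ^ 6 - 2)]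

/-! ## §2  The registered first shell -/

/-- A registered first-shell neighbour `y k = f i v`, `‖v‖ = 1`, lies at distance `∈ [ν, 1.0011ν]` and is not `i`. [this file] -/
theorem first_shell_dist {y : Fin N → EuclideanSpace ℝ (Fin 3)} {i : Fin N} (hν : 0 < nearestDist y i)
    {A : Fin N → (EuclideanSpace ℝ (Fin 3) →ₗ[ℝ] EuclideanSpace ℝ (Fin 3))} {Qf : Fin N → (EuclideanSpace ℝ (Fin 3) →ₗᵢ[ℝ] EuclideanSpace ℝ (Fin 3))}
    {P : Fin N → Finset (EuclideanSpace ℝ (Fin 3))} {f : Fin N → EuclideanSpace ℝ (Fin 3) → EuclideanSpace ℝ (Fin 3)}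
    (hA : ∀ j, dist (y j) (y i) ≤ 12 * nearestDist y i → ∀ v ∈ P j, ‖A j v - Qf j v‖ ≤ 1 / 1000)
    (hf : ∀ j, dist (y j) (y i) ≤ 12 * nearestDist y i → ∀ v ∈ P j,
      f j v ∈ Set.range y ∧ dist (f j v) (y j + nearestDist y j • A j v) ≤ 1 / 10 ^ 4 * nearestDist y j)
    {v : EuclideanSpace ℝ (Fin 3)} (hv : v ∈ P i) (h1 : ‖v‖ = 1) {k : Fin N} (hk : f i v = y k) :
    k ≠ i ∧ nearestDist y i ≤ dist (y i) (y k) ∧ dist (y i) (y k) ≤ 10011 / 10000 * nearestDist y i := by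
  have hii : dist (y i) (y i) ≤ 12 * nearestDist y i := by rw [dist_self]; positivity
  have hq : ‖Qf i v‖ = 1 := by rw [LinearIsometry.norm_map, h1]
  have hAv := hA i hii v hv
  have hup : ‖A i v‖ ≤ 1 + 1 / 1000 := by have := norm_sub_norm_le (A i v) (Qf i v); linarith
  have hlo : 1 - 1 / 1000 ≤ ‖A i v‖ := by have := norm_sub_norm_le (Qf i v) (A i v); rw [norm_sub_rev] at this; linarith
  have hfd := (hf i hii v hv).2
  rw [hk] at hfd
  have hsm : dist (y i + nearestDist y i • A i v) (y i) = nearestDist y i * ‖A i v‖ := by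
    rw [dist_eq_norm, add_sub_cancel_left, norm_smul, Real.norm_of_nonneg hν.le]
  have hupd : dist (y i) (y k) ≤ 10011 / 10000 * nearestDist y i := by
    have h := dist_triangle (y k) (y i + nearestDist y i • A i v) (y i)
    rw [dist_comm (y i) (y k)]
    nlinarith [h, hsm, hfd, hup, hν]
  have hlod : 0 < dist (y i) (y k) := by
    have h := dist_triangle (y i + nearestDist y i • A i v) (y k) (y i)
    rw [dist_comm (y i + nearestDist y i • A i v) (y k)] at h
    rw [dist_comm (y i) (y k)]
    nlinarith [h, hsm, hfd, hlo, hν]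
  have hki : k ≠ i := by
    intro h
    rw [h, dist_self] at hlod
    exact lt_irrefl _ hlod
  exact ⟨hki, nearestDist_le_dist y hki, hupd⟩

/-- TWELVE registered first-shell sites: any set containing every `k` with `y k = f i v`, `v ∈ P i`, `‖v‖ = 1` has `≥ 12` elements. [this file] -/
theorem twelve_le_card {y : Fin N → EuclideanSpace ℝ (Fin 3)} {i : Fin N} (hν : 0 < nearestDist y i)
    {A : Fin N → (EuclideanSpace ℝ (Fin 3) →ₗ[ℝ] EuclideanSpace ℝ (Fin 3))}
    {P : Fin N → Finset (EuclideanSpace ℝ (Fin 3))} {f : Fin N → EuclideanSpace ℝ (Fin 3) → EuclideanSpace ℝ (Fin 3)}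
    (hP : ∀ j, dist (y j) (y i) ≤ 12 * nearestDist y i → (P j = fccTwoShellPattern ∨ P j = hcpTwoShellPattern))
    (hf : ∀ j, dist (y j) (y i) ≤ 12 * nearestDist y i → ∀ v ∈ P j,
      f j v ∈ Set.range y ∧ dist (f j v) (y j + nearestDist y j • A j v) ≤ 1 / 10 ^ 4 * nearestDist y j)
    (hinj : ∀ j, dist (y j) (y i) ≤ 12 * nearestDist y i → Set.InjOn (f j) ↑(P j))
    (S : Finset (Fin N)) (hS : ∀ k, (∃ v ∈ P i, ‖v‖ = 1 ∧ f i v = y k) → k ∈ S) : 12 ≤ S.card := by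
  have hii : dist (y i) (y i) ≤ 12 * nearestDist y i := by rw [dist_self]; positivity
  haveI : Nonempty (Fin N) := ⟨i⟩
  have key : ∀ K : Finset (EuclideanSpace ℝ (Fin 3)), K ⊆ P i → (∀ v ∈ K, ‖v‖ = 1) → K.card ≤ S.card := by
    intro K hK hK1
    refine Finset.card_le_card_of_injOn (fun v => Function.invFun y (f i v)) ?_ ?_
    · intro v hv
      have hyv : y (Function.invFun y (f i v)) = f i v := Function.invFun_eq ((hf i hii v (hK hv)).1)
      exact hS _ ⟨v, hK hv, hK1 v hv, hyv.symm⟩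
    · intro v hv v' hv' h
      have h' := congrArg y h
      have e1 : y (Function.invFun y (f i v)) = f i v := Function.invFun_eq ((hf i hii v (hK hv)).1)
      have e2 : y (Function.invFun y (f i v')) = f i v' := Function.invFun_eq ((hf i hii v' (hK hv')).1)
      dsimp only at h'
      rw [e1, e2] at h'
      exact hinj i hii (hK hv) (hK hv') h'
  rcases hP i hii with h | h
  · rw [← card_fccKissingPattern]
    exact key _ (h ▸ fccKissingPattern_subset) fun v hv => norm_eq_one_of_mem_fccKissingPattern hv
  · rw [← card_hcpKissingPattern]
    exact key _ (h ▸ hcpKissingPattern_subset) fun v hv => norm_eq_one_of_mem_hcpKissingPattern hv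

/-! ## §3  Table rows and keys -/

/-- An injective family of rows of a duplicate-free table has `Σ t ≤` the table's `t`-total. [this file] -/
theorem sum_le_table {ι : Type*} (S : Finset ι) (E : ι → ℤ × ℤ × ℕ × ℕ × ℕ) (tb : List (ℤ × ℤ × ℕ × ℕ × ℕ))
    (hmem : ∀ m ∈ S, E m ∈ tb) (hinj : Set.InjOn E ↑S) (hnd : tb.Nodup) : ∑ m ∈ S, tOfE (E m) ≤ (tb.map tOfE).sum := by
  rw [← Finset.sum_image hinj, ← List.sum_toFinset _ hnd]
  refine Finset.sum_le_sum_of_subset_of_nonneg (fun e he => ?_) fun _ _ _ => Nat.zero_le _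
  obtain ⟨m, hm, rfl⟩ := Finset.mem_image.1 he
  exact List.mem_toFinset.2 (hmem m hm)

/-- Cancellation of a common subtrahend. [this file] -/
theorem eq_of_tsub_eq {x x' z : T3} (h : tsub x z = tsub x' z) : x = x' := by
  obtain ⟨a, b, c⟩ := x
  obtain ⟨a', b', c'⟩ := x'
  obtain ⟨p, q, r⟩ := z
  simp only [tsub, Prod.mk.injEq] at h ⊢
  exact ⟨by linarith [h.1], by linarith [h.2.1], by linarith [h.2.2]⟩

/-- SAME KEY ⇒ SAME SITE: two inner sites read (coarsely) in the same layer `ℓ` whose hex coordinates agree up to the common sign are equal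
(clause 5 of the record). [this file] -/
theorem site_eq {y : Fin N → EuclideanSpace ℝ (Fin 3)} {i : Fin N} {B : EuclideanSpace ℝ (Fin 3) →ₗ[ℝ] EuclideanSpace ℝ (Fin 3)}
    {ref : ℤ → T3} {x₀ : T3} (hx₀L : InLayer x₀)
    (hRec5 : ∀ (m m' : Fin N) (r : T3), 9967 / 10000 * (9026 / 10000 * nearestDist y i) ≤ nearestDist y m' →
      ‖y m - y i - B (mv r)‖ ≤ dR (nearestDist y i) 31 + 1 / 10 ^ 4 * (10347 / 10000 * nearestDist y i) + tauR (nearestDist y i) 31 →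
      ‖y m' - y i - B (mv r)‖ ≤ dR (nearestDist y i) 31 + 1 / 10 ^ 4 * (10347 / 10000 * nearestDist y i) + tauR (nearestDist y i) 31 → m = m')
    {m₁ m₂ : Fin N} {ℓ : ℤ} {x₁ x₂ : T3} (hx₁ : InLayer x₁) (hx₂ : InLayer x₂)
    (hm₁ : ‖y m₁ - y i - B (mv (tadd (ref ℓ) x₁))‖ ≤
      dR (nearestDist y i) 31 + 1 / 10 ^ 4 * (10347 / 10000 * nearestDist y i) + tauR (nearestDist y i) 31)
    (hm₂ : ‖y m₂ - y i - B (mv (tadd (ref ℓ) x₂))‖ ≤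
      dR (nearestDist y i) 31 + 1 / 10 ^ 4 * (10347 / 10000 * nearestDist y i) + tauR (nearestDist y i) 31)
    (hfl₂ : 9967 / 10000 * (9026 / 10000 * nearestDist y i) ≤ nearestDist y m₂)
    {a₁ b₁ a₂ b₂ : ℤ} (ha₁ : (tsub x₁ x₀).1 = 3 * a₁) (hb₁ : (tsub x₁ x₀).2.1 = 3 * b₁) (ha₂ : (tsub x₂ x₀).1 = 3 * a₂)
    (hb₂ : (tsub x₂ x₀).2.1 = 3 * b₂) {sg : ℤ} (hsg : sg ≠ 0) (hka : sg * a₁ = sg * a₂) (hkb : sg * b₁ = sg * b₂) : m₁ = m₂ := by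
  have ha : a₁ = a₂ := mul_left_cancel₀ hsg hka
  have hb : b₁ = b₂ := mul_left_cancel₀ hsg hkb
  have hw₁ := (inLayer_tsub hx₁ hx₀L).1
  have hw₂ := (inLayer_tsub hx₂ hx₀L).1
  have heq : tsub x₁ x₀ = tsub x₂ x₀ := by
    refine Prod.ext ?_ (Prod.ext ?_ ?_)
    · rw [ha₁, ha₂, ha]
    · rw [hb₁, hb₂, hb]
    · linarith [hw₁, hw₂, ha₁, ha₂, hb₁, hb₂, ha, hb]
  have hx : x₁ = x₂ := eq_of_tsub_eq heq
  subst hx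
  exact hRec5 m₁ m₂ _ hfl₂ hm₁ hm₂

/-! ## §4  ★ The table total over the inner sites -/

/-- ★ **TABLE TOTAL.**  Record data as in «InnerS».`site_bound`; a set `R` of inner sites `m ≠ i` (`dist ≤ 106/25·ν`), none a registered first-shell
neighbour of `i`, each with a clause-4 label `ref (L m) + X m` (coarse reading, own-spacing floor).  Then the `t`-fields of their table rows total
`≤ 2435912 = M₀ + 2(M₁ + ⋯ + M₅)`. [this file] -/
theorem table_total {y : Fin N → EuclideanSpace ℝ (Fin 3)} (hy : Function.Injective y) {i : Fin N} (hν : 0 < nearestDist y i)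
    {A : Fin N → (EuclideanSpace ℝ (Fin 3) →ₗ[ℝ] EuclideanSpace ℝ (Fin 3))} {Qf : Fin N → (EuclideanSpace ℝ (Fin 3) →ₗᵢ[ℝ] EuclideanSpace ℝ (Fin 3))}
    {P : Fin N → Finset (EuclideanSpace ℝ (Fin 3))} {f : Fin N → EuclideanSpace ℝ (Fin 3) → EuclideanSpace ℝ (Fin 3)}
    {B : EuclideanSpace ℝ (Fin 3) →ₗ[ℝ] EuclideanSpace ℝ (Fin 3)}
    (hP : ∀ j, dist (y j) (y i) ≤ 12 * nearestDist y i → (P j = fccTwoShellPattern ∨ P j = hcpTwoShellPattern))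
    (hA : ∀ j, dist (y j) (y i) ≤ 12 * nearestDist y i → ∀ v ∈ P j, ‖A j v - Qf j v‖ ≤ 1 / 1000)
    (hf : ∀ j, dist (y j) (y i) ≤ 12 * nearestDist y i → ∀ v ∈ P j,
      f j v ∈ Set.range y ∧ dist (f j v) (y j + nearestDist y j • A j v) ≤ 1 / 10 ^ 4 * nearestDist y j)
    (hinj : ∀ j, dist (y j) (y i) ≤ 12 * nearestDist y i → Set.InjOn (f j) ↑(P j))
    (hex : ∀ j, dist (y j) (y i) ≤ 12 * nearestDist y i → ∀ m, m ≠ j → dist (y m) (y j) ≤ (3 / 2 + 1 / 450) * nearestDist y j →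
      ∃ v ∈ P j, f j v = y m)
    (hBlo : ∀ z, 399 / 400 * nearestDist y i * ‖z‖ ≤ ‖B z‖) (hBup : ∀ z, ‖B z‖ ≤ 401 / 400 * nearestDist y i * ‖z‖)
    (hseed : ∃ (M₀ : EuclideanSpace ℝ (Fin 3) →ₗᵢ[ℝ] EuclideanSpace ℝ (Fin 3)) (C₀ : List T3), Estab y A P B i i M₀ C₀ (0, 0, 0) 0 0)
    {ref : ℤ → T3} {Cz : ℤ → List T3} {e : ℤ → ℤ} {x₀ : T3}
    (hRec1 : ∀ ℓ : ℤ, -5 ≤ ℓ → ℓ ≤ 5 → Cz ℓ ∈ [fccL, fccNegL, hcpL, hcpAltL] ∧ thsum (ref ℓ) = 6 * ℓ ∧ (ref ℓ).2.1 = (ref ℓ).1 ∧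
      (3 : ℤ) ∣ ((ref ℓ).2.1 - (ref ℓ).2.2) ∧
      ∀ u : T3, InLayer (tsub (tadd (2 * ℓ, 2 * ℓ, 2 * ℓ) u) (ref ℓ)) → |u.1| ≤ 18 - |ℓ| → |u.2.1| ≤ 18 - |ℓ| → |u.2.2| ≤ 18 - |ℓ| →
        ∃ k : Fin N, ∃ M : EuclideanSpace ℝ (Fin 3) →ₗᵢ[ℝ] EuclideanSpace ℝ (Fin 3),
          dist (y k) (y i) ≤ 12 * nearestDist y i ∧ 9026 / 10000 * nearestDist y i ≤ nearestDist y k ∧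
          nearestDist y k ≤ 10347 / 10000 * nearestDist y i ∧
          Estab y A P B i k M (Cz ℓ) (tadd (2 * ℓ, 2 * ℓ, 2 * ℓ) u) (tauR (nearestDist y i) 31) (dR (nearestDist y i) 31))
    (hRec2 : ∀ ℓ : ℤ, -5 ≤ ℓ → ℓ ≤ 4 → (e ℓ = 1 ∨ e ℓ = -1) ∧ ref (ℓ + 1) = tadd (ref ℓ) (capv 1 (e ℓ) (1, 1, -2)) ∧
      (∀ δ ∈ dL, capv 1 (e ℓ) δ ∈ Cz ℓ) ∧ (∀ δ ∈ dL, capv (-1) (-(e ℓ)) δ ∈ Cz (ℓ + 1)))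
    (hx₀L : InLayer x₀) (hx₀ : tadd (ref 0) x₀ = (0, 0, 0))
    (hRec5 : ∀ (m m' : Fin N) (r : T3), 9967 / 10000 * (9026 / 10000 * nearestDist y i) ≤ nearestDist y m' →
      ‖y m - y i - B (mv r)‖ ≤ dR (nearestDist y i) 31 + 1 / 10 ^ 4 * (10347 / 10000 * nearestDist y i) + tauR (nearestDist y i) 31 →
      ‖y m' - y i - B (mv r)‖ ≤ dR (nearestDist y i) 31 + 1 / 10 ^ 4 * (10347 / 10000 * nearestDist y i) + tauR (nearestDist y i) 31 → m = m')
    {L : Fin N → ℤ} {X : Fin N → T3} (R : Finset (Fin N))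
    (hR : ∀ m ∈ R, m ≠ i ∧ dist (y m) (y i) ≤ 106 / 25 * nearestDist y i ∧ (∀ v ∈ P i, ‖v‖ = 1 → f i v ≠ y m) ∧
      -5 ≤ L m ∧ L m ≤ 5 ∧ InLayer (X m) ∧
      ‖y m - y i - B (mv (tadd (ref (L m)) (X m)))‖ ≤
        dR (nearestDist y i) 31 + 1 / 10 ^ 4 * (10347 / 10000 * nearestDist y i) + tauR (nearestDist y i) 31 ∧
      9967 / 10000 * (9026 / 10000 * nearestDist y i) ≤ nearestDist y m) :
    ∑ m ∈ R, tOfE (eOf (L m) ((tadd (ref (L m)) x₀).1 - 2 * L m) ((tsub (X m) x₀).1 / 3) ((tsub (X m) x₀).2.1 / 3)) ≤ 2435912 := by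
  have hmaps : ∀ m ∈ R, L m ∈ Finset.Icc (-5 : ℤ) 5 := fun m hm => Finset.mem_Icc.2 ⟨(hR m hm).2.2.2.1, (hR m hm).2.2.2.2.1⟩
  rw [← Finset.sum_fiberwise_of_maps_to hmaps]
  have hM : ∑ ℓ ∈ Finset.Icc (-5 : ℤ) 5, Mq ℓ.natAbs = 2435912 := by decide
  rw [← hM]
  refine Finset.sum_le_sum fun ℓ hℓ => ?_
  obtain ⟨hℓ1, hℓ2⟩ := Finset.mem_Icc.1 hℓ
  -- the column offset of layer `ℓ`
  obtain ⟨σ, hσ1, hσ2, hcol⟩ := col_form hRec2 hx₀ hℓ1 hℓ2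
  have hσ : (tadd (ref ℓ) x₀).1 = 2 * ℓ + σ := by
    have h := congrArg Prod.fst hcol
    dsimp only at h
    linarith [h]
  obtain ⟨-, hsum, hnd⟩ := layer_sound hℓ1 hℓ2 hσ1 hσ2
  -- per site of the fibre: membership, keys (from «InnerS».`site_bound`)
  have hfib : ∀ m ∈ R.filter (fun m => L m = ℓ),
      (tsub (X m) x₀).1 = 3 * ((tsub (X m) x₀).1 / 3) ∧ (tsub (X m) x₀).2.1 = 3 * ((tsub (X m) x₀).2.1 / 3) ∧
      ‖y m - y i - B (mv (tadd (ref ℓ) (X m)))‖ ≤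
        dR (nearestDist y i) 31 + 1 / 10 ^ 4 * (10347 / 10000 * nearestDist y i) + tauR (nearestDist y i) 31 ∧
      eOf ℓ σ ((tsub (X m) x₀).1 / 3) ((tsub (X m) x₀).2.1 / 3) ∈ tblOf ℓ.natAbs σ.natAbs ∧
      (eOf ℓ σ ((tsub (X m) x₀).1 / 3) ((tsub (X m) x₀).2.1 / 3)).1 = sgOf σ * ((tsub (X m) x₀).1 / 3) ∧
      (eOf ℓ σ ((tsub (X m) x₀).1 / 3) ((tsub (X m) x₀).2.1 / 3)).2.1 = sgOf σ * ((tsub (X m) x₀).2.1 / 3) := by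
    intro m hm
    obtain ⟨hmR, hLm⟩ := Finset.mem_filter.1 hm
    obtain ⟨hmi, hdm, hnot, -, -, hx, hread, -⟩ := hR m hmR
    rw [hLm] at hread
    have hw := inLayer_tsub hx hx₀L
    have ha : (tsub (X m) x₀).1 = 3 * ((tsub (X m) x₀).1 / 3) := (Int.mul_ediv_cancel' hw.2.1).symm
    have hb : (tsub (X m) x₀).2.1 = 3 * ((tsub (X m) x₀).2.1 / 3) := (Int.mul_ediv_cancel' hw.2.2).symm
    obtain ⟨h1, h2, h3, -⟩ :=
      site_bound hy hν hP hA hf hinj hex hBlo hBup hseed hRec1 hRec2 hx₀L hx₀ hRec5 hmi hdm hnot hℓ1 hℓ2 hx hread hσ ha hb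
    exact ⟨ha, hb, hread, h1, h2, h3⟩
  calc ∑ m ∈ R.filter (fun m => L m = ℓ), tOfE (eOf (L m) ((tadd (ref (L m)) x₀).1 - 2 * L m) ((tsub (X m) x₀).1 / 3) ((tsub (X m) x₀).2.1 / 3))
      = ∑ m ∈ R.filter (fun m => L m = ℓ), tOfE (eOf ℓ σ ((tsub (X m) x₀).1 / 3) ((tsub (X m) x₀).2.1 / 3)) := by
        refine Finset.sum_congr rfl fun m hm => ?_
        rw [(Finset.mem_filter.1 hm).2, hσ, show 2 * ℓ + σ - 2 * ℓ = σ by ring]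
    _ ≤ ((tblOf ℓ.natAbs σ.natAbs).map tOfE).sum := by
        refine sum_le_table _ _ _ (fun m hm => (hfib m hm).2.2.2.1) (fun m₁ hm₁ m₂ hm₂ heq => ?_) hnd
        obtain ⟨ha₁, hb₁, hr₁, -, hk₁, hl₁⟩ := hfib m₁ hm₁
        obtain ⟨ha₂, hb₂, hr₂, -, hk₂, hl₂⟩ := hfib m₂ hm₂
        have hka : sgOf σ * ((tsub (X m₁) x₀).1 / 3) = sgOf σ * ((tsub (X m₂) x₀).1 / 3) := by rw [← hk₁, ← hk₂, heq]
        have hkb : sgOf σ * ((tsub (X m₁) x₀).2.1 / 3) = sgOf σ * ((tsub (X m₂) x₀).2.1 / 3) := by rw [← hl₁, ← hl₂, heq]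
        exact site_eq hx₀L hRec5 (hR m₁ (Finset.mem_filter.1 hm₁).1).2.2.2.2.2.1 (hR m₂ (Finset.mem_filter.1 hm₂).1).2.2.2.2.2.1
          hr₁ hr₂ (hR m₂ (Finset.mem_filter.1 hm₂).1).2.2.2.2.2.2.2 ha₁ hb₁ ha₂ hb₂ (sgOf_ne_zero σ) hka hkb
    _ ≤ Mq ℓ.natAbs := hsum

end Summit.AtomisticToContinuum.Crystallization.Theorems.OverbindingBudgetAffineCompressedCutInnerA
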